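import Literature.NumberTheory.EllipticCurves.Rank1Residual.X10RankOne
import Literature.NumberTheory.EllipticCurves.Rank1Residual.Typed.CasselsLowerBound
import HarnessLib

/-!
# The Kolyvagin squeeze: `BSD(E,p)` at `p ∣ #Ш_an` rows from Kolyvagin's Heegner-index bound,
  one descent certificate and Cassels–Tate — with NO reduction-type hypothesis at `p`

HONEST FRAMING (cell `b2b-bsdres`, verbatim): prove what is provable now; shrink each hard class to
its core with data; no claim beyond stated classes.

**The gap addressed (unit `b2b-bsdres-sha-2`, GEN 13, rule V12).** After GEN 12 the odd-`p` Ш-census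
of the rank-`≤ 1` residual (`SHA-CENSUS.md`) has 66 bucket-(d) pairs `(E, 3)` with `r_an(E) = 0`,
`#Ш_an(E) = 9` and `Ш(E)[3] ⊇ (ℤ/3)²` CERTIFIED by two independent full `3`-descents, but NO typed
upper bound: 56 of them are additive at `3` (class X4) and potentially multiplicative or without a
`3 ∤ c_ℓ` / (ram) witness, so that every catalogued upper-bound engine fails on a NAMED hypothesis —
Kato 2004 Thm. 14.5 (3) (potentially good reduction), Kim–Nakamura 2020 (Assumption 1.1 (1),
non-exceptionality, `3 ∤ Tam`), Wuthrich 2014 Prop. 21 (`p` not additive), Jetchev 2008 Cor. 1.5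
(Hypothesis (∗): `p ∤ N`), Skinner–Urban / Cha 2005 / Miller 2011 Thm. 5.4 (`p² ∤ N`).

**The lever.** Kolyvagin's theorem AS PRINTED by McCallum (LMS LN 153 (1991) §1, p. 296; tree fact
`Kolyvagin1990_padicValNat_card_sha_le`, companion `kolyvagin`) has NO hypothesis on the reduction of
`E` at `p` and none on `p ∤ N`: for an imaginary quadratic `K` with the Heegner hypothesis for `N`, a
Heegner point `y_K ∈ E(K)` of infinite order and an odd prime `p` with `ρ̄_{E,p}` onto,
`ord_p #Ш(E/K) ≤ 2·ord_p [E(K) : ℤ y_K]`. With the odd-part splitting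
`#Ш(E/K)[p^∞] = #Ш(E/ℚ)[p^∞] · #Ш(E^{(d_K)}/ℚ)[p^∞]` (JSW 2017 §7.4.1; tree theorem
`card_primaryComponent_sha_baseChange_quadratic_of_odd_of_finite`, packaged as
`Rank1Residual.padicValNat_card_primaryComponent_sha_add_le_of_twist`) this gives, for EVERY curve of
analytic rank `≤ 1` and every admissible `K` whose twist `E^{(d_K)}` also has analytic rank `≤ 1`
(so that both `Ш[p^∞]` are finite by Gross–Zagier–Kolyvagin, `hGZK`):

  `ord_p #Ш(E/ℚ)[p^∞] + ord_p #Ш(E^{(d_K)}/ℚ)[p^∞] ≤ 2·ord_p [E(K) : ℤ y_K]`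
  (`padicValNat_sha_add_twist_le_of_kolyvagin_index`).

So ONE finite certificate — the EXACT `p`-adic valuation `k` of the Heegner index, computed by the
census engine `koly3.gp` (GEN 13: the Heegner point `y_K` as an EXACT point of `E(K)`, identified by
a Gross–Zagier height inequality, `y_K = p·Q` with `Q ∉ pE(K)` by a reduction witness, `E(K)[p] = 0`)
— bounds `ord_p #Ш(E/ℚ)` by `2k` FROM ABOVE (`missingUpperBoundAt_of_kolyvagin_index`), and the
census's descent certificate `p^{2k-1} ∣ #Ш(E/ℚ)` with Cassels–Tate squareness bounds it by `2k`
FROM BELOW (`Typed.missingLowerBoundAt_of_casselsTate_of_pow_dvd`): if `ord_p #Ш_an(E) = 2k` then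
`BSD(E,p)` (`bsdp_of_kolyvagin_index_of_casselsTate_of_pow_dvd`), and as a by-product
`Ш(E^{(d_K)}/ℚ)[p] = 0` (`padicValNat_sha_twist_eq_zero_of_kolyvagin_index_of_pow_dvd`). The case
`k = 0` (`p ∤ [E(K) : ℤ y_K]`, Gross 1991 Prop. 2.1 (2)) needs neither a descent nor Cassels–Tate
(`bsdp_of_kolyvagin_index_zero`).

Junk values: `(AddSubgroup.zmultiples P).index = 0` when the index is infinite and
`padicValNat p 0 = 0`, so the certificate hypothesis `ord_p(index) ≤ k` is WEAKER in the junk case,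
never false; under `kolyvagin N W K` (rank `E(K) = 1`) the index is a genuine positive integer
(see the module docstring of `KolyvaginShaIndexBound.lean`).

All inputs are PUBLISHED named facts entering as hypotheses (`kolyvagin`,
`Kolyvagin1990_padicValNat_card_sha_le`, `rank_eq_analyticRank_of_analyticRank_le_one`,
`exists_casselsTate_pairing`); the per-curve data (`K`, `P`, `Wd`, `k`, `q`, the descent
divisibility) enter as explicit hypotheses, certified outside Lean by the census
(`run/shared/lean/b2b/bsd-rank1-residual/b2b-bsdres-sha-2/SHA-CENSUS.md` §4g, `certs/sha/koly3/`).
Theorems only; no `sorry`, no new axiom. Per pair; no class label changes.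

References: McCallum 1991 §1 [McCallumLMS1991]; Gross 1991 §1–2 [GrossLMS1991]; Kolyvagin 1990
[KolyvaginEulerSystems1990]; Jetchev–Skinner–Wan 2017 §7.4 [JetchevSkinnerWan2017]; Gross–Zagier 1986
[GrossZagier1986]; Silverman AEC Thm. X.4.14 [SilvermanAEC2009]; Miller 2011 Def. 1.1 [Miller2011LMS].
-/

noncomputable section

open scoped Classical

open WeierstrassCurve Literature.NumberTheory.EllipticCurves
open Literature.NumberTheory.EllipticCurves.Rank1Residual
open Literature.NumberTheory.EllipticCurves.Rank1Residual.Typed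

namespace Summit.BirchSwinnertonDyer.Rank1Residual

universe u

/-- **Kolyvagin's index bound with the twist on the left** (any odd `p`, analytic rank `≤ 1`, NO
reduction hypothesis at `p`): granted `kolyvagin N W K`, `Kolyvagin1990_padicValNat_card_sha_le N W K`
(McCallum 1991 §1) and Gross–Zagier–Kolyvagin for `E` and for a `ℚ`-model `Wd` of `E^{(d_K)}` (both
of analytic rank `≤ 1`, whence both `Ш` finite), for a Heegner point `P = y_K` of infinite order over
an imaginary quadratic `K` with the Heegner hypothesis for `N` and `ρ̄_{E,p}` onto: if
`ord_p [E(K) : ℤ P] ≤ k` then `ord_p #Ш(E/ℚ)[p^∞] + ord_p #Ш(E^{(d_K)}/ℚ)[p^∞] ≤ 2k`.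
[cite: McCallumLMS1991, §1 Theorem (Kolyvagin), p. 296]
[cite: JetchevSkinnerWan2017, §7.4.1 (p. 30)] -/
theorem padicValNat_sha_add_twist_le_of_kolyvagin_index {N : ℕ} [NeZero N]
    (hGZK : rank_eq_analyticRank_of_analyticRank_le_one)
    (W : WeierstrassCurve ℚ) [W.IsElliptic] (hr : W.analyticRank ≤ 1)
    (K : Type) [Field K] [NumberField K]
    (hKo : kolyvagin N W K) (hKB : Kolyvagin1990_padicValNat_card_sha_le N W K)
    (hK : IsImaginaryQuadratic K) (hH : SatisfiesHeegnerHypothesis N K)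
    {P : (W.baseChange K).toAffine.Point} (hP : IsHeegnerPoint N W K P) (hnt : ¬ IsOfFinAddOrder P)
    (p : ℕ) [Fact p.Prime] (hp : p ≠ 2) (hρ : W.HasSurjectiveModNGaloisRep p)
    (Wd : WeierstrassCurve ℚ) [Wd.IsElliptic]
    (hWd : ∃ C : VariableChange ℚ, C • W.quadraticTwist (NumberField.discr K : ℚ) = Wd)
    (hrD : Wd.analyticRank ≤ 1)
    {k : ℕ} (hI : padicValNat p (AddSubgroup.zmultiples P).index ≤ k) :
    padicValNat p (Nat.card (AddCommGroup.primaryComponent W.sha p)) +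
      padicValNat p (Nat.card (AddCommGroup.primaryComponent Wd.sha p)) ≤ 2 * k := by
  haveI : Finite W.sha := (hGZK W hr).2
  haveI : Finite Wd.sha := (hGZK Wd hrD).2
  haveI : Finite (AddCommGroup.primaryComponent W.sha p) :=
    Finite.of_injective _ Subtype.val_injective
  haveI : Finite (AddCommGroup.primaryComponent Wd.sha p) :=
    Finite.of_injective _ Subtype.val_injective
  obtain ⟨-, hfinK⟩ := hKo hK hH hP hnt
  haveI : Finite ((W.baseChange K).sha) := hfinK
  have hbound := hKB hK hH hP hnt (Fact.out : p.Prime) hp hρ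
  rw [← padicValNat_card_addPrimaryComponent (A := (W.baseChange K).sha) p] at hbound
  have hKle : padicValNat p
      (Nat.card (AddCommGroup.primaryComponent (W.baseChange K).sha p)) ≤ 2 * k :=
    hbound.trans (by omega)
  exact padicValNat_card_primaryComponent_sha_add_le_of_twist W K hK.1 Wd hWd p hp hKle le_rfl

/-- **The typed UPPER half from the Heegner-index certificate** (any odd `p`, analytic rank `≤ 1`,
no reduction hypothesis at `p`): under the hypotheses of
`padicValNat_sha_add_twist_le_of_kolyvagin_index`, if `#Ш_an(E) = q` with `2k ≤ ord_p q` then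
`ord_p #Ш(E/ℚ) ≤ ord_p #Ш_an(E)` (`MissingUpperBoundAt W p`). The twist's `Ш[p^∞]` is dropped
(it is `≥ 0`), not required to vanish. [cite: McCallumLMS1991, §1 Theorem (Kolyvagin), p. 296]
[cite: Miller2011LMS, Def. 1.1 (arXiv:1010.2431 p. 3)] -/
theorem missingUpperBoundAt_of_kolyvagin_index {N : ℕ} [NeZero N]
    (hGZK : rank_eq_analyticRank_of_analyticRank_le_one)
    (W : WeierstrassCurve ℚ) [W.IsElliptic] (hr : W.analyticRank ≤ 1)
    (K : Type) [Field K] [NumberField K]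
    (hKo : kolyvagin N W K) (hKB : Kolyvagin1990_padicValNat_card_sha_le N W K)
    (hK : IsImaginaryQuadratic K) (hH : SatisfiesHeegnerHypothesis N K)
    {P : (W.baseChange K).toAffine.Point} (hP : IsHeegnerPoint N W K P) (hnt : ¬ IsOfFinAddOrder P)
    (p : ℕ) [Fact p.Prime] (hp : p ≠ 2) (hρ : W.HasSurjectiveModNGaloisRep p)
    (Wd : WeierstrassCurve ℚ) [Wd.IsElliptic]
    (hWd : ∃ C : VariableChange ℚ, C • W.quadraticTwist (NumberField.discr K : ℚ) = Wd)
    (hrD : Wd.analyticRank ≤ 1)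
    {k : ℕ} (hI : padicValNat p (AddSubgroup.zmultiples P).index ≤ k)
    {q : ℚ} (hq : shaAn W = (q : ℂ)) (hv : (2 * k : ℤ) ≤ padicValRat p q) :
    MissingUpperBoundAt W p := by
  haveI : Finite W.sha := (hGZK W hr).2
  have hle := padicValNat_sha_add_twist_le_of_kolyvagin_index hGZK W hr K hKo hKB hK hH hP hnt p
    hp hρ Wd hWd hrD hI
  refine ⟨q, hq, le_trans ?_ hv⟩
  rw [WeierstrassCurve.shaOrder, ← padicValNat_card_addPrimaryComponent (A := W.sha) p]
  exact_mod_cast (show padicValNat p (Nat.card (AddCommGroup.primaryComponent W.sha p)) ≤ 2 * k by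
    omega)

/-- **The Kolyvagin squeeze** (any odd `p`, analytic rank `≤ 1`, NO reduction hypothesis at `p`):
granted GZK, Kolyvagin (McCallum 1991 §1) and the Cassels–Tate pairing over `ℚ` (`hCT`, Silverman
AEC Thm. X.4.14: `#Ш` is a square once finite), for a Heegner datum `(K, P = y_K)` with `ρ̄_{E,p}`
onto and a `ℚ`-model `Wd` of the twist of analytic rank `≤ 1`: if `ord_p [E(K) : ℤ y_K] ≤ k`
(Heegner-index certificate), `#Ш_an(E) = q` with `ord_p q = 2k`, and `p^{2k-1} ∣ #Ш(E/ℚ)` (for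
`k = 1`: ONE `p`-descent certificate `Ш(E)[p] ≠ 0`), then Miller's `BSD(E,p)` holds, with
`#Ш(E/ℚ)[p^∞] = p^{2k}` exactly. [cite: McCallumLMS1991, §1 Theorem (Kolyvagin), p. 296]
[cite: SilvermanAEC2009, Thm. X.4.14] [cite: Miller2011LMS, §1 and Def. 1.1] -/
theorem bsdp_of_kolyvagin_index_of_casselsTate_of_pow_dvd {N : ℕ} [NeZero N]
    (hGZK : rank_eq_analyticRank_of_analyticRank_le_one)
    (hCT : exists_casselsTate_pairing (K := ℚ))
    (W : WeierstrassCurve ℚ) [W.IsElliptic] (hr : W.analyticRank ≤ 1)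
    (K : Type) [Field K] [NumberField K]
    (hKo : kolyvagin N W K) (hKB : Kolyvagin1990_padicValNat_card_sha_le N W K)
    (hK : IsImaginaryQuadratic K) (hH : SatisfiesHeegnerHypothesis N K)
    {P : (W.baseChange K).toAffine.Point} (hP : IsHeegnerPoint N W K P) (hnt : ¬ IsOfFinAddOrder P)
    (p : ℕ) [Fact p.Prime] (hp : p ≠ 2) (hρ : W.HasSurjectiveModNGaloisRep p)
    (Wd : WeierstrassCurve ℚ) [Wd.IsElliptic]
    (hWd : ∃ C : VariableChange ℚ, C • W.quadraticTwist (NumberField.discr K : ℚ) = Wd)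
    (hrD : Wd.analyticRank ≤ 1)
    {k : ℕ} (hI : padicValNat p (AddSubgroup.zmultiples P).index ≤ k)
    {q : ℚ} (hq : shaAn W = (q : ℂ)) (hv : padicValRat p q = 2 * k)
    (hdvd : p ^ (2 * k - 1) ∣ W.shaOrder) : BSDp W p :=
  bsdp_of_missingPPartAt W p hGZK hr
    (missingPPartAt_of_lower_of_upper W p
      (missingLowerBoundAt_of_casselsTate_of_pow_dvd W p hCT (hGZK W hr).2 hq hv.le hdvd)
      (missingUpperBoundAt_of_kolyvagin_index hGZK W hr K hKo hKB hK hH hP hnt p hp hρ Wd hWd hrD hI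
        hq hv.ge))

/-- **By-product of the squeeze: the twist's `Ш[p]` vanishes.** Under the hypotheses of
`bsdp_of_kolyvagin_index_of_casselsTate_of_pow_dvd` (without the analytic `#Ш_an`),
`ord_p #Ш(E^{(d_K)}/ℚ)[p^∞] = 0`: the lower bound `2k ≤ ord_p #Ш(E/ℚ)` (descent + Cassels–Tate)
exhausts Kolyvagin's `2k`. [cite: McCallumLMS1991, §1 Theorem (Kolyvagin), p. 296]
[cite: SilvermanAEC2009, Thm. X.4.14] -/
theorem padicValNat_sha_twist_eq_zero_of_kolyvagin_index_of_pow_dvd {N : ℕ} [NeZero N]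
    (hGZK : rank_eq_analyticRank_of_analyticRank_le_one)
    (hCT : exists_casselsTate_pairing (K := ℚ))
    (W : WeierstrassCurve ℚ) [W.IsElliptic] (hr : W.analyticRank ≤ 1)
    (K : Type) [Field K] [NumberField K]
    (hKo : kolyvagin N W K) (hKB : Kolyvagin1990_padicValNat_card_sha_le N W K)
    (hK : IsImaginaryQuadratic K) (hH : SatisfiesHeegnerHypothesis N K)
    {P : (W.baseChange K).toAffine.Point} (hP : IsHeegnerPoint N W K P) (hnt : ¬ IsOfFinAddOrder P)
    (p : ℕ) [Fact p.Prime] (hp : p ≠ 2) (hρ : W.HasSurjectiveModNGaloisRep p)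
    (Wd : WeierstrassCurve ℚ) [Wd.IsElliptic]
    (hWd : ∃ C : VariableChange ℚ, C • W.quadraticTwist (NumberField.discr K : ℚ) = Wd)
    (hrD : Wd.analyticRank ≤ 1)
    {k : ℕ} (hI : padicValNat p (AddSubgroup.zmultiples P).index ≤ k)
    (hdvd : p ^ (2 * k - 1) ∣ W.shaOrder) :
    padicValNat p (Nat.card (AddCommGroup.primaryComponent Wd.sha p)) = 0 := by
  haveI : Finite W.sha := (hGZK W hr).2
  have hle := padicValNat_sha_add_twist_le_of_kolyvagin_index hGZK W hr K hKo hKB hK hH hP hnt p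
    hp hρ Wd hWd hrD hI
  have hsq : IsSquare W.shaOrder := isSquare_shaOrder_of_casselsTate hCT W (hGZK W hr).2
  have hn : W.shaOrder ≠ 0 := (WeierstrassCurve.shaOrder_pos W (hGZK W hr).2).ne'
  have hlow : 2 * k ≤ padicValNat p W.shaOrder :=
    two_mul_le_padicValNat_of_isSquare_of_pow_dvd hsq hn hdvd
  rw [WeierstrassCurve.shaOrder, ← padicValNat_card_addPrimaryComponent (A := W.sha) p] at hlow
  omega

/-- **The case `k = 0`** (Gross 1991 Prop. 2.1 (2): `p ∤ [E(K) : ℤ y_K]`, odd surjective `p`): no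
descent certificate and no Cassels–Tate are needed — if `ord_p [E(K) : ℤ y_K] = 0` and
`ord_p #Ш_an(E) = 0` then `BSD(E,p)`, for `E` of analytic rank `≤ 1` with NO reduction hypothesis at
`p`, provided the twist `E^{(d_K)}` has analytic rank `≤ 1`. (Compare
`Rank1Residual.bsdp_of_kolyvagin_of_twist`, which instead asks `BSD(E^{(d_K)},p)`.)
[cite: GrossLMS1991, §2 Prop. 2.1 (2)] [cite: McCallumLMS1991, §1 Theorem (Kolyvagin), p. 296]
[cite: Miller2011LMS, §1 and Def. 1.1] -/
theorem bsdp_of_kolyvagin_index_zero {N : ℕ} [NeZero N]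
    (hGZK : rank_eq_analyticRank_of_analyticRank_le_one)
    (W : WeierstrassCurve ℚ) [W.IsElliptic] (hr : W.analyticRank ≤ 1)
    (K : Type) [Field K] [NumberField K]
    (hKo : kolyvagin N W K) (hKB : Kolyvagin1990_padicValNat_card_sha_le N W K)
    (hK : IsImaginaryQuadratic K) (hH : SatisfiesHeegnerHypothesis N K)
    {P : (W.baseChange K).toAffine.Point} (hP : IsHeegnerPoint N W K P) (hnt : ¬ IsOfFinAddOrder P)
    (p : ℕ) [Fact p.Prime] (hp : p ≠ 2) (hρ : W.HasSurjectiveModNGaloisRep p)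
    (Wd : WeierstrassCurve ℚ) [Wd.IsElliptic]
    (hWd : ∃ C : VariableChange ℚ, C • W.quadraticTwist (NumberField.discr K : ℚ) = Wd)
    (hrD : Wd.analyticRank ≤ 1)
    (hI : padicValNat p (AddSubgroup.zmultiples P).index = 0)
    {q : ℚ} (hq : shaAn W = (q : ℂ)) (hv : padicValRat p q = 0) : BSDp W p :=
  bsdp_of_missingPPartAt W p hGZK hr
    (missingPPartAt_of_lower_of_upper W p ⟨q, hq, by rw [hv]; positivity⟩
      (missingUpperBoundAt_of_kolyvagin_index hGZK W hr K hKo hKB hK hH hP hnt p hp hρ Wd hWd hrD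
        (k := 0) hI.le hq (by rw [hv]; simp)))

/-- **Census shape, bucket (d) at `p = 3`** (`r_an(E) = 0`, `#Ш_an(E) = 9`, `Ш(E)[3] ≠ 0` by the
census's two full `3`-descents, `ρ̄_{E,3}` onto, Heegner field `K` with `y_K = 3·Q`, `Q ∉ 3E(K)`,
`E(K)[3] = 0`, and `L'(E^{(d_K)},1) ≠ 0` — the `koly3` certificate): `BSD(E,3)`, whatever the
reduction type of `E` at `3`. [cite: McCallumLMS1991, §1 Theorem (Kolyvagin), p. 296]
[cite: SilvermanAEC2009, Thm. X.4.14] [cite: Miller2011LMS, §1 and Def. 1.1] -/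
theorem bsdp_three_rankZero_of_kolyvagin_index_one_of_casselsTate {N : ℕ} [NeZero N]
    (hGZK : rank_eq_analyticRank_of_analyticRank_le_one)
    (hCT : exists_casselsTate_pairing (K := ℚ))
    (W : WeierstrassCurve ℚ) [W.IsElliptic] (hr : W.analyticRank = 0)
    (K : Type) [Field K] [NumberField K]
    (hKo : kolyvagin N W K) (hKB : Kolyvagin1990_padicValNat_card_sha_le N W K)
    (hK : IsImaginaryQuadratic K) (hH : SatisfiesHeegnerHypothesis N K)
    {P : (W.baseChange K).toAffine.Point} (hP : IsHeegnerPoint N W K P) (hnt : ¬ IsOfFinAddOrder P)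
    (hρ : W.HasSurjectiveModNGaloisRep 3)
    (Wd : WeierstrassCurve ℚ) [Wd.IsElliptic]
    (hWd : ∃ C : VariableChange ℚ, C • W.quadraticTwist (NumberField.discr K : ℚ) = Wd)
    (hrD : Wd.analyticRank ≤ 1)
    (hI : padicValNat 3 (AddSubgroup.zmultiples P).index ≤ 1)
    {q : ℚ} (hq : shaAn W = (q : ℂ)) (hv : padicValRat 3 q = 2) (hdvd : 3 ∣ W.shaOrder) :
    BSDp W 3 :=
  haveI : Fact (Nat.Prime 3) := ⟨by norm_num⟩
  bsdp_of_kolyvagin_index_of_casselsTate_of_pow_dvd hGZK hCT W (by rw [hr]; exact zero_le_one) K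
    hKo hKB hK hH hP hnt 3 (by decide) hρ Wd hWd hrD (k := 1) hI hq (by simpa using hv)
    (by simpa using hdvd)

end Summit.BirchSwinnertonDyer.Rank1Residual

end
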